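import Mathlib
import Summits.AtomisticToContinuum.Crystallization.Theses.ChartedPlanarOrder
import Summits.AtomisticToContinuum.Crystallization.Theorems.ChartedPlanarOrderPalmDoor
import Summits.AtomisticToContinuum.Crystallization.Theorems.ChartedPlanarOrderExactLayerDoor

/-!
# Charted-straightening door for `ZeroExcessLocallyLayered` (route ChartedPlanarOrder)

Tree twin of the decomp-a2c lens-3 generation-10 node «ChartedStraightening»
(cell file `run/shared/lean/pub/decomp-a2c/decomp-a2c-lens-3/g10/ChartedStraightening.lean`, where the full
rationale, EQUIV accounting, findings and dead ends are recorded).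

The node cuts the g9 residual `Z` = `ChartedPlanarOrder.ZeroExcessLocallyLayered` (item
stmt-AtomisticToContinuum-33842: zero-excess clean stationary Nash laws are a.s. exactly layered at every point) into

* `A′` = `ChartedPlanarOrder.CleanSetsBarlowCharted` (support item; potential-free two-shell layer theorem at
  tolerance 1/16: every nonempty everywhere-(1/16, 9/10, 1)-two-shell-good set is bond-charted by an ideal Barlow
  stacking — the robust version of the PROVED `PalmUnimodularRigidity.ShellsToBarlowChart` at Z's own tolerance), and
* `N` = `ChartedPlanarOrder.ChartedZeroExcessLayered` (crux item; Z's hypotheses verbatim plus an a.s. Barlow bond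
  chart of the support, Z's conclusion verbatim — the law-level family-rigidity residual, to be attacked by the
  symmetric-straightening competitor and the squeeze with the PROVED `PalmUnimodularRigidity.UnimodularEnergyLowerBound`),

and this file lands the kernel `A′ → N → Z` (`zeroExcessLocallyLayered_of_chartedStraightening`, the composition of
the line «charted-straightening» registered on 33842) together with its consequences up the already-landed doors:
`A′ → N → G → W → CleanLawsChargeLayers` (via `ChartedPlanarOrderExactLayerDoor`, p776924) and
`T → A′ → N → G → W → CleanBallPlanarOrderMaj` (via `ChartedPlanarOrderPalmDoor`, p775704).
-/

namespace Summit.AtomisticToContinuum.Crystallization.Theorems.ChartedPlanarOrderStraighteningDoor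

open MeasureTheory

/-- The node's kernel: a clean rooted law is carried by the support `{p | μ {p} ≠ 0}`, which is the rooted
hard-core set itself, hence nonempty and everywhere two-shell good; `A′` charts it, and `N` concludes. -/
theorem zeroExcessLocallyLayered_of_chartedStraightening :
    Summit.AtomisticToContinuum.Crystallization.Theses.ChartedPlanarOrder.CleanSetsBarlowCharted →
    Summit.AtomisticToContinuum.Crystallization.Theses.ChartedPlanarOrder.ChartedZeroExcessLayered →
      Summit.AtomisticToContinuum.Crystallization.Theses.ChartedPlanarOrder.ZeroExcessLocallyLayered := by
  intro hA hN δ hδ P hP hroot hmecke hen hclean hnash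
  refine hN δ hδ P hP hroot hmecke hen hclean hnash ?_
  filter_upwards [hroot, hclean] with μ hr hcl
  obtain ⟨S₀, h0, -, hμ⟩ := hr
  have hsupp : {p : EuclideanSpace ℝ (Fin 3) | μ {p} ≠ 0} = S₀ := by
    rw [hμ]
    exact Summit.AtomisticToContinuum.Crystallization.Theorems.ChartedPlanarOrderExactLayerDoor.setOf_count_restrict_singleton_ne_zero S₀
  have hne : ({p : EuclideanSpace ℝ (Fin 3) | μ {p} ≠ 0}).Nonempty := ⟨0, by rw [hsupp]; exact h0⟩
  exact hA {p : EuclideanSpace ℝ (Fin 3) | μ {p} ≠ 0} hne (fun q hq => hcl q hq)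

/-- Up one level: with the two open siblings `G` (33843) and `W` (33844) the node proves `L` (33483) through the
landed exact-layer door (p776924). -/
theorem cleanLawsChargeLayers_of_chartedStraightening
    (hA : Summit.AtomisticToContinuum.Crystallization.Theses.ChartedPlanarOrder.CleanSetsBarlowCharted)
    (hN : Summit.AtomisticToContinuum.Crystallization.Theses.ChartedPlanarOrder.ChartedZeroExcessLayered)
    (hG : Summit.AtomisticToContinuum.Crystallization.Theses.ChartedPlanarOrder.LocallyLayeredIsLayered)
    (hW : Summit.AtomisticToContinuum.Crystallization.Theses.ChartedPlanarOrder.LayeredSpacingWindow) :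
    Summit.AtomisticToContinuum.Crystallization.Theses.ChartedPlanarOrder.CleanLawsChargeLayers :=
  Summit.AtomisticToContinuum.Crystallization.Theorems.ChartedPlanarOrderExactLayerDoor.cleanLawsChargeLayers_of_exactLayers
    (zeroExcessLocallyLayered_of_chartedStraightening hA hN) hG hW

/-- Up two levels: with the door half `T` (33484) the node proves `CB⁺` (33480) through the landed palm door
(p775704). -/
theorem cleanBallPlanarOrderMaj_of_chartedStraightening
    (hT : Summit.AtomisticToContinuum.Crystallization.Theses.ChartedPlanarOrder.MinimisingLawTransfer)
    (hA : Summit.AtomisticToContinuum.Crystallization.Theses.ChartedPlanarOrder.CleanSetsBarlowCharted)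
    (hN : Summit.AtomisticToContinuum.Crystallization.Theses.ChartedPlanarOrder.ChartedZeroExcessLayered)
    (hG : Summit.AtomisticToContinuum.Crystallization.Theses.ChartedPlanarOrder.LocallyLayeredIsLayered)
    (hW : Summit.AtomisticToContinuum.Crystallization.Theses.ChartedPlanarOrder.LayeredSpacingWindow) :
    Summit.AtomisticToContinuum.Crystallization.Theses.ChartedPlanarOrder.CleanBallPlanarOrderMaj :=
  Summit.AtomisticToContinuum.Crystallization.Theorems.ChartedPlanarOrderExactLayerDoor.cleanBallPlanarOrderMaj_of_exactLayers
    hT (zeroExcessLocallyLayered_of_chartedStraightening hA hN) hG hW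

end Summit.AtomisticToContinuum.Crystallization.Theorems.ChartedPlanarOrderStraighteningDoor
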